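import Summits.Ventures.WeilGRH.UniformConductorFloorJointDataLog9
import HarnessLib

/-!
# GRH arm (rh-explicit, venture WeilGRH): the kernel check of the joint cell certificate `certOddLog9` (t = log 3), part A

Cell `rh-explicit`, WEIL TRACK — GRH ARM (weil-grh-1).  `JointCert.checkFrame` and the first half of the cells of the
odd pseudo-key certificate `certOddLog9` (`UniformConductorFloorJointDataLog9.lean`, `J = 352`), by `decide +kernel`.  The `352` cells are
split into two ranges of `176` (`JointCert.cellsRange`; one range per file keeps the kernel's memory guard quiet); `JointCert.cellsLoop_spec`
reassembles them in `UniformConductorFloorJointFloorsLog9.lean`.  No definitions; no named facts; standard axioms. [folklore]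
-/

namespace Summit.Ventures.WeilGRH

namespace UniformFloor

set_option maxHeartbeats 0 in
set_option maxRecDepth 100000 in
/-- The frame of `certOddLog9` checks (shape, `φ` bounds, shifts, exact slab masses, exact constant, `e^{2t} ≤ 10`). [folklore] -/
theorem certOddLog9_checkFrame : certOddLog9.checkFrame = true := by
  decide +kernel

set_option maxHeartbeats 0 in
set_option maxRecDepth 100000 in
/-- The cell inequalities `0 ≤ j < 176` of `certOddLog9` (the zipper `JointCert.cellsRange 0 176`). [folklore] -/
theorem certOddLog9_cellsA : certOddLog9.cellsRange 0 176 = true := by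
  decide +kernel

end UniformFloor

end Summit.Ventures.WeilGRH
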